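import Summits.NavierStokesRegularity.NavierStokesRegularity.Theorems.LerayQuarterDissipationFiniteDissipationLiouvilleCalmSliceForward
import Summits.NavierStokesRegularity.NavierStokesRegularity.Theorems.LerayQuarterDissipationFiniteDissipationLiouvilleSliceLSix
import Mathlib.MeasureTheory.Group.Measure
import HarnessLib

/-!
# Crux `FiniteDissipationLiouville` (stmt-NavierStokesRegularity-22144): the QUIET-SLICE leaf —
# a finite-dissipation Type-I profile with ONE instant of small dimensionless dissipation is
# regular at the apex

Theorems file of route `LerayQuarterDissipation` (seat ns-lqd-p2 g7; `--supports` the crux; the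
one-slice converter suggested by the line lead, g4 census). Navier–Stokes regularity is NOT proved
by anything here; no summit is.

The stratum `𝒟_{C,K}`: Type-I ancient mild fields `w` in the KNSS gauge (`IsTypeIAncientMild C w`)
with the quarter-rate dissipation law `∫ ‖∇w(s)‖² ≤ K/√(−s)` for all `s < 0`. Write
`D_w(t) := √(−t) ∫ ‖∇w(t)‖²` for the DIMENSIONLESS (scale-invariant) dissipation of the slice `t`,
so that the law reads `D_w ≤ K`. The line already knows two dissipation floors for SINGULAR members:
the gap (`D_w ≤ K₀` at all times ⇒ `w ≡ 0`, p579719) and the sub-threshold leaf (`D_w ≤ K₁ ≤ K₀` on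
log-time windows of unbounded length ⇒ regular, p589634). This file proves the INSTANTANEOUS floor:

* `slice_eq_zero_of_lintegral_fderiv_sq_eq_zero` — a member of `𝒟_{C,K}` whose slice `s < 0` has
  `∫ ‖∇w(s)‖² = 0` has `w(s) ≡ 0`: the slice is `C¹` with vanishing gradient, hence constant, and a
  constant slice in `L⁶(ℝ³)` (`memLp_six_slice` — the gauge kills the Sobolev constant) is zero
  because Lebesgue measure on `ℝ³` is infinite;
* `false_of_quiet_seq` — the compactness core: there is NO sequence of singular members of
  `𝒟_{C,K}` whose slices at `t = −1` have dissipation `≤ 1/(k+1)`. KNSS compactness across members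
  (`Compactness.seqLimit`: uniform convergence on the slab pieces, pointwise convergence of the
  gradients) produces a limit member `W ∈ 𝒟_{C,K}` (`law_of_seqLimit`) which is singular
  (`persistent_singularity_seq`) and, by Fatou at the slice `−1`
  (`Subthreshold.lintegral_fderiv_sq_le_of_tendsto_of_eventually`), has `∫ ‖∇W(−1)‖² = 0`; so
  `W(−1) ≡ 0`, and forward uniqueness of bounded mild solutions from the zero slice
  (`CalmSlice.not_singular_of_zero_slice`, KNSS §4) makes `W` regular at the apex — contradiction;
* `quietSlice_leaf` — **the leaf**: for all `C, K` there is `δ = δ(C,K) > 0` such that every member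
  of `𝒟_{C,K}` with ONE slice `t < 0` obeying `∫ ‖∇w(t)‖² ≤ δ/√(−t)` (i.e. `D_w(t) ≤ δ`) is bounded
  on some backward cylinder at the origin (scale the quiet instant to `−1`; the dissipation, the law,
  the class and the singular clause are all scale invariant);
* `dissipation_floor_of_singular` — contrapositive, the quotable reading: **a SINGULAR member of
  the stratum dissipates MORE than `δ(C,K)/√(−t)` at EVERY instant `t < 0`** — there is no quiet
  instant anywhere in the life of a finite-dissipation Type-I singularity.

HONEST FRAMING. `δ(C,K)` comes from a compactness argument and is not explicit (the explicit
absolute threshold `K₀` of the gap needs the bound at ALL times). The statement removes from the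
wall of the crux (`∀ c>1, TypeIDSSLiouville c` ∧ the wandering stub) every profile with a quiet
instant; it does not touch the wall itself.

References: Koch–Nadirashvili–Seregin–Šverák, Acta Math. 203 (2009) = arXiv:0709.3599, §4
(compactness of bounded ancient mild solutions; uniqueness of bounded mild solutions), §6;
Albritton–Barker, arXiv:1811.00502, Prop. 2.3 (persistence of singularities).
-/

noncomputable section

-- the summit and its single sub-problem share the name (CONVENTIONS §1), as in every Theorems file
set_option linter.dupNamespace false

namespace Summit.NavierStokesRegularity.NavierStokesRegularity.Theorems.FiniteDissipationLiouville.QuietSlice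

open MeasureTheory Set Filter Topology Metric Function
open Literature.Analysis Literature.Analysis.FluidPDE
open Summit.NavierStokesRegularity.NavierStokesRegularity.Theorems.FiniteDissipationLiouville
open scoped ENNReal NNReal

/-! ### A slice with zero dissipation vanishes -/

/-- **A slice of a member of `𝒟_{C,K}` with zero dissipation is identically zero.** If
`∫ ‖∇w(s)‖² = 0` at some `s < 0`, the (smooth) slice has vanishing gradient everywhere, hence is
constant; the slice lies in `L⁶(ℝ³)` (`memLp_six_slice`), and Lebesgue measure on `ℝ³` is infinite,
so the constant is `0`. [cite: KochNadirashviliSereginSverak2009, §1 p. 3 (arXiv:0709.3599) — the gauge excludes the parasitic constants] -/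
theorem slice_eq_zero_of_lintegral_fderiv_sq_eq_zero {C K : ℝ}
    {w : ℝ → EuclideanSpace ℝ (Fin 3) → EuclideanSpace ℝ (Fin 3)}
    (hw : IsTypeIAncientMild C w)
    (hlaw : ∀ s : ℝ, s < 0 →
      ∫⁻ x, ‖fderiv ℝ (w s) x‖ₑ ^ 2 ≤ ENNReal.ofReal (K / Real.sqrt (-s)))
    {s : ℝ} (hs : s < 0) (h0 : ∫⁻ x, ‖fderiv ℝ (w s) x‖ₑ ^ 2 = 0) :
    ∀ x, w s x = 0 := by
  -- the gradient vanishes a.e., hence everywhere (it is continuous)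
  have hmeas : AEMeasurable (fun x => ‖fderiv ℝ (w s) x‖ₑ ^ 2) volume :=
    ((measurable_fderiv ℝ (w s)).enorm.pow_const 2).aemeasurable
  have hae : ∀ᵐ x ∂volume, ‖fderiv ℝ (w s) x‖ₑ ^ 2 = 0 := (lintegral_eq_zero_iff' hmeas).1 h0
  have hae' : fderiv ℝ (w s) =ᵐ[volume] fun _ => (0 : EuclideanSpace ℝ (Fin 3) →L[ℝ] EuclideanSpace ℝ (Fin 3)) := by
    filter_upwards [hae] with x hx
    have h1 : ‖fderiv ℝ (w s) x‖ₑ = 0 := (pow_eq_zero_iff two_ne_zero).mp hx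
    rwa [enorm_eq_nnnorm, ENNReal.coe_eq_zero, nnnorm_eq_zero] at h1
  have hsmooth : ContDiff ℝ (⊤ : ℕ∞) (w s) := hw.contDiff_slice hs
  have hcontF : Continuous (fderiv ℝ (w s)) := hsmooth.continuous_fderiv (by simp)
  have hF0 : fderiv ℝ (w s) = fun _ => (0 : EuclideanSpace ℝ (Fin 3) →L[ℝ] EuclideanSpace ℝ (Fin 3)) :=
    (Continuous.ae_eq_iff_eq volume hcontF continuous_const).1 hae'
  have hdiff : Differentiable ℝ (w s) := hsmooth.differentiable (by simp)
  have hconst : ∀ x y, w s x = w s y :=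
    is_const_of_fderiv_eq_zero hdiff (fun x => congrFun hF0 x)
  -- the slice is in `L⁶(ℝ³)`, and `ℝ³` has infinite measure
  obtain ⟨CL, -, hL6⟩ := Birth.memLp_six_slice
  have hmem : MemLp (w s) 6 volume := (hL6 C K w hw hlaw s hs).1
  have e : w s = fun _ => w s 0 := funext fun x => hconst x 0
  rw [e] at hmem
  have h6 := (memLp_const_iff (by norm_num) (by norm_num)).1 hmem
  have huniv : (volume : Measure (EuclideanSpace ℝ (Fin 3))) univ = ∞ :=
    measure_univ_of_isAddLeftInvariant _
  have hc : w s 0 = 0 := by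
    rcases h6 with h | h
    · exact h
    · rw [huniv] at h
      exact absurd h (lt_irrefl _)
  intro x
  rw [hconst x 0, hc]

/-! ### The compactness core -/

/-- **No sequence of singular members of `𝒟_{C,K}` has asymptotically quiet slices at `t = −1`.**
If `w k ∈ 𝒟_{C,K}` are singular at the apex and `∫ ‖∇(w k)(−1)‖² ≤ 1/(k+1)`, then KNSS compactness
across members gives a singular limit member `W` (persistence of the singularity) with
`∫ ‖∇W(−1)‖² = 0` (Fatou along the pointwise convergence of the gradients); so `W(−1) ≡ 0`, and
forward uniqueness from the zero slice makes `W` bounded near the apex — a contradiction. [cite: KochNadirashviliSereginSverak2009, §4 (arXiv:0709.3599 p. 8)] -/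
theorem false_of_quiet_seq {C K : ℝ}
    {w : ℕ → ℝ → EuclideanSpace ℝ (Fin 3) → EuclideanSpace ℝ (Fin 3)}
    (hwk : ∀ k, IsTypeIAncientMild C (w k))
    (hlaw : ∀ k, ∀ s : ℝ, s < 0 →
      ∫⁻ x, ‖fderiv ℝ (w k s) x‖ₑ ^ 2 ≤ ENNReal.ofReal (K / Real.sqrt (-s)))
    (hsing : ∀ k, ∀ r > 0, ∀ M : ℝ, ∃ t ∈ Ioo (-(r ^ 2)) (0 : ℝ),
      ∃ x ∈ ball (0 : EuclideanSpace ℝ (Fin 3)) r, M < ‖w k t x‖)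
    (hquiet : ∀ k, ∫⁻ x, ‖fderiv ℝ (w k (-1)) x‖ₑ ^ 2 ≤ ENNReal.ofReal (1 / ((k : ℝ) + 1))) :
    False := by
  -- KNSS compactness across members
  obtain ⟨ψ, hψ, W, hW, hunif, -, hgrad⟩ := Compactness.seqLimit hwk
  have hψt : Tendsto ψ atTop atTop := hψ.tendsto_atTop
  -- the limit is a member of `𝒟_{C,K}` ...
  have hWlaw : ∀ s : ℝ, s < 0 →
      ∫⁻ x, ‖fderiv ℝ (W s) x‖ₑ ^ 2 ≤ ENNReal.ofReal (K / Real.sqrt (-s)) :=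
    Compactness.law_of_seqLimit (Kinf := K) (Kk := fun _ => K) hψt hlaw
      (fun ε hε => Eventually.of_forall fun _ => by linarith) hgrad
  -- ... singular at the apex ...
  have hWsing := Compactness.persistent_singularity_seq (w := fun j => w (ψ j))
    (fun j => hwk (ψ j)) (fun j => hlaw (ψ j)) (fun j => hsing (ψ j)) hW hunif
  -- ... and its slice `−1` has zero dissipation (Fatou with eventual bounds)
  have hzero : ∫⁻ x, ‖fderiv ℝ (W (-1)) x‖ₑ ^ 2 = 0 := by
    refine le_antisymm (ENNReal.le_of_forall_pos_le_add fun ε hε _ => ?_) bot_le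
    rw [zero_add, ← ENNReal.ofReal_coe_nnreal]
    refine Subthreshold.lintegral_fderiv_sq_le_of_tendsto_of_eventually
      (hgrad (-1) (by norm_num)) ?_
    -- eventually `1/(ψ j + 1) ≤ ε`
    have hεpos : (0 : ℝ) < ε := by exact_mod_cast hε
    obtain ⟨N, hN⟩ := exists_nat_gt (1 / (ε : ℝ))
    filter_upwards [hψt.eventually_ge_atTop N] with j hj
    refine (hquiet (ψ j)).trans (ENNReal.ofReal_le_ofReal ?_)
    have hNpos : (0 : ℝ) < (N : ℝ) := lt_trans (by positivity) hN
    have h1 : (N : ℝ) ≤ (ψ j : ℝ) := by exact_mod_cast hj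
    have h2 : 1 / (ε : ℝ) < (ψ j : ℝ) + 1 := by linarith
    rw [div_le_iff₀ (by positivity)]
    have := (div_lt_iff₀ hεpos).1 h2
    linarith
  -- hence `W(−1) ≡ 0`, and forward uniqueness contradicts the singularity of `W`
  have hslice : ∀ x, W (-1) x = 0 :=
    slice_eq_zero_of_lintegral_fderiv_sq_eq_zero hW hWlaw (by norm_num) hzero
  exact CalmSlice.not_singular_of_zero_slice hW (by norm_num : (-1 : ℝ) < 0) hslice hWsing

/-! ### The leaf and its contrapositive -/

/-- **The quiet-slice leaf of `FiniteDissipationLiouville`.** For all `C, K` there is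
`δ = δ(C,K) > 0` such that every Type-I ancient mild field `w` (KNSS gauge, constant `C`) with the
quarter-rate dissipation law (constant `K`) that has ONE slice `t < 0` with
`∫ ‖∇w(t)‖² ≤ δ/√(−t)` is bounded on some backward cylinder `(−r², 0) × B(0, r)`: scale the quiet
instant to `t = −1` (the dimensionless dissipation `√(−t)∫‖∇w(t)‖²`, the law, the class and the
singular clause are scale invariant) and apply `false_of_quiet_seq` to a putative sequence of
counterexamples with `δ = 1/(k+1)`. [cite: KochNadirashviliSereginSverak2009, §4 (arXiv:0709.3599 p. 8); AlbrittonBarker2019, Prop. 2.3] -/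
theorem quietSlice_leaf : ∀ (C K : ℝ), ∃ δ > 0,
    ∀ (w : ℝ → EuclideanSpace ℝ (Fin 3) → EuclideanSpace ℝ (Fin 3)),
      IsTypeIAncientMild C w →
      (∀ s : ℝ, s < 0 → ∫⁻ x, ‖fderiv ℝ (w s) x‖ₑ ^ 2 ≤ ENNReal.ofReal (K / Real.sqrt (-s))) →
      (∃ t < 0, ∫⁻ x, ‖fderiv ℝ (w t) x‖ₑ ^ 2 ≤ ENNReal.ofReal (δ / Real.sqrt (-t))) →
      ¬ (∀ r > 0, ∀ M : ℝ, ∃ t ∈ Ioo (-(r ^ 2)) (0 : ℝ),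
        ∃ x ∈ ball (0 : EuclideanSpace ℝ (Fin 3)) r, M < ‖w t x‖) := by
  intro C K
  by_contra hcon
  push Not at hcon
  -- a sequence of singular members with a `1/(k+1)`-quiet instant `t k < 0`
  have hk : ∀ k : ℕ, ∃ (w : ℝ → EuclideanSpace ℝ (Fin 3) → EuclideanSpace ℝ (Fin 3)) (t : ℝ),
      IsTypeIAncientMild C w ∧
      (∀ s : ℝ, s < 0 → ∫⁻ x, ‖fderiv ℝ (w s) x‖ₑ ^ 2 ≤ ENNReal.ofReal (K / Real.sqrt (-s))) ∧
      t < 0 ∧ ∫⁻ x, ‖fderiv ℝ (w t) x‖ₑ ^ 2 ≤ ENNReal.ofReal ((1 / ((k : ℝ) + 1)) / Real.sqrt (-t)) ∧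
      (∀ r > 0, ∀ M : ℝ, ∃ t ∈ Ioo (-(r ^ 2)) (0 : ℝ),
        ∃ x ∈ ball (0 : EuclideanSpace ℝ (Fin 3)) r, M < ‖w t x‖) := by
    intro k
    obtain ⟨w, hw, hlaw, ⟨t, ht, hq⟩, hsing⟩ := hcon (1 / ((k : ℝ) + 1)) (by positivity)
    exact ⟨w, t, hw, hlaw, ht, hq, hsing⟩
  choose w t hw hlaw ht hq hsing using hk
  -- rescale the quiet instant to `−1`
  set c : ℕ → ℝ := fun k => Real.sqrt (-t k) with hc_def
  have hc : ∀ k, 0 < c k := fun k => Real.sqrt_pos.2 (neg_pos.2 (ht k))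
  set v : ℕ → ℝ → EuclideanSpace ℝ (Fin 3) → EuclideanSpace ℝ (Fin 3) :=
    fun k => nsRescale (c k) (w k) with hv_def
  have hv : ∀ k, IsTypeIAncientMild C (v k) := fun k => isTypeIAncientMild_nsRescale (hw k) (hc k)
  have hvlaw : ∀ k, ∀ s : ℝ, s < 0 →
      ∫⁻ x, ‖fderiv ℝ (v k s) x‖ₑ ^ 2 ≤ ENNReal.ofReal (K / Real.sqrt (-s)) :=
    fun k => RecurrentReductionD.dissipationLaw_nsRescale (hlaw k) (hc k)
  have hvsing : ∀ k, ∀ r > 0, ∀ M : ℝ, ∃ t ∈ Ioo (-(r ^ 2)) (0 : ℝ),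
      ∃ x ∈ ball (0 : EuclideanSpace ℝ (Fin 3)) r, M < ‖v k t x‖ :=
    fun k => RecurrentReductionD.singularAtOrigin_nsRescale (hsing k) (hc k)
  have hvquiet : ∀ k, ∫⁻ x, ‖fderiv ℝ (v k (-1)) x‖ₑ ^ 2 ≤ ENNReal.ofReal (1 / ((k : ℝ) + 1)) := by
    intro k
    have e : c k ^ 2 * (-1 : ℝ) = t k := by
      rw [hc_def]; dsimp only; rw [Real.sq_sqrt (neg_nonneg.2 (ht k).le)]; ring
    have hq' : ∫⁻ x, ‖fderiv ℝ (w k (c k ^ 2 * (-1))) x‖ₑ ^ 2 ≤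
        ENNReal.ofReal ((1 / ((k : ℝ) + 1)) / Real.sqrt (-(c k ^ 2 * (-1)))) := by
      rw [e]; exact hq k
    have h1 := Subthreshold.law_nsRescale_of_law_at (hc k) (by norm_num : (-1 : ℝ) < 0) hq'
    simpa using h1
  exact false_of_quiet_seq hv hvlaw hvsing hvquiet

/-- **Instantaneous dissipation floor of a finite-dissipation Type-I singularity.** For all
`C, K` there is `δ = δ(C,K) > 0` such that every member of `𝒟_{C,K}` which IS singular at the apex
dissipates more than `δ/√(−t)` at EVERY instant `t < 0`: `δ/√(−t) < ∫ ‖∇w(t)‖²`. (Contrapositive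
of `quietSlice_leaf`.) [cite: KochNadirashviliSereginSverak2009, §4 (arXiv:0709.3599 p. 8)] -/
theorem dissipation_floor_of_singular : ∀ (C K : ℝ), ∃ δ > 0,
    ∀ (w : ℝ → EuclideanSpace ℝ (Fin 3) → EuclideanSpace ℝ (Fin 3)),
      IsTypeIAncientMild C w →
      (∀ s : ℝ, s < 0 → ∫⁻ x, ‖fderiv ℝ (w s) x‖ₑ ^ 2 ≤ ENNReal.ofReal (K / Real.sqrt (-s))) →
      (∀ r > 0, ∀ M : ℝ, ∃ t ∈ Ioo (-(r ^ 2)) (0 : ℝ),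
        ∃ x ∈ ball (0 : EuclideanSpace ℝ (Fin 3)) r, M < ‖w t x‖) →
      ∀ t < 0, ENNReal.ofReal (δ / Real.sqrt (-t)) < ∫⁻ x, ‖fderiv ℝ (w t) x‖ₑ ^ 2 := by
  intro C K
  obtain ⟨δ, hδ, h⟩ := quietSlice_leaf C K
  refine ⟨δ, hδ, fun w hw hlaw hsing t ht => ?_⟩
  by_contra hle
  push Not at hle
  exact h w hw hlaw ⟨t, ht, hle⟩ hsing

end Summit.NavierStokesRegularity.NavierStokesRegularity.Theorems.FiniteDissipationLiouville.QuietSlice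

end
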